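import Summits.CriticalPhenomena.PercolationContinuityZ3.Theorems.PercNearOneGluingAdditiveGluingBhkOneAny
import HarnessLib

/-! # Crux `PercNearOneGluing.AdditiveGluing` (stmt-CriticalPhenomena-4576), line `tieline`
(skeleton v12) — stub `stub_diagOne_c7` (BHK Thm. 1.3 diagonal atom, `S = {s}`, `X = {x, y}`,
the two point literals `{s ↔ o}` and `{s ↔ b}`)

Helper file for the crux skeleton of the line `tieline` (lead
prover-line-stmt-CriticalPhenomena-4576-c7-0): proves exactly the registered stub signature
`stub_diagOne_c7`; lands with `--supports stmt-CriticalPhenomena-4576`.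

## Content

Finite weighted graph on `Fin n` (`μ = prodBernoulli w` on `BondConfig (Fin n)`, events
`{u ↔ v} = openConn u v`), one relay `s` different from the two vertices `x, y`, points `o, b`,
and the decreasing separation event `N := {s ↮ x} ∩ {s ↮ y} = (openConn s x)ᶜ ∩ (openConn s y)ᶜ`
(the cluster `C_s` contains neither `x` nor `y`).  Then

`μ(N ∩ {s ↔ o}) · μ(N ∩ {s ↔ b}) ≤ μ(N) · μ(N ∩ ({s ↔ o} ∩ {s ↔ b}))`,

i.e. given `N` the two increasing functions `1{s ↔ o}` and `1{s ↔ b}` of the cluster `C_s` are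
positively correlated (van den Berg–Häggström–Kahn 2006, Thm. 1.3).  This is the literal
specialisation `S := {s}`, `X := {x, y}` of the landed set lemma `stub_bhkOneAny_c7`
(file `…AdditiveGluingBhkOneAny`), after the three set identities
`{ω | ∀ s' ∈ {s}, ∀ x' ∈ {x, y}, s' ↮ x'} = N`, `⋃_{s' ∈ {s}} {s' ↔ o} = {s ↔ o}`,
`⋃_{s' ∈ {s}} {s' ↔ b} = {s ↔ b}`.
-/

namespace Summit.CriticalPhenomena.PercolationContinuityZ3.Theorems

open MeasureTheory Set Literature.Probability.LatticeModels Literature.Probability.Percolation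

noncomputable section
open Classical

/-- **BHK 2006 Thm. 1.3, diagonal atom for the cluster of `S = {s}` given `s ↮ x`, `s ↮ y`
(point literals `{s ↔ o}` and `{s ↔ b}`):** for `s ≠ x`, `s ≠ y` and `N = {s ↮ x} ∩ {s ↮ y}`,
`μ(N ∩ {s ↔ o}) μ(N ∩ {s ↔ b}) ≤ μ(N) μ(N ∩ ({s ↔ o} ∩ {s ↔ b}))`
— the instance `S := {s}`, `X := {x, y}` of the landed `stub_bhkOneAny_c7`.
[cite: VandenbergHaggstromKahn2005, Thm. 1.3 (p. 6)] -/
theorem stub_diagOne_c7 : ∀ (n : ℕ) (w : Sym2 (Fin n) → unitInterval) (s x y o b : Fin n), s ≠ x → s ≠ y → (prodBernoulli w).real ((openConn s x)ᶜ ∩ (openConn s y)ᶜ ∩ openConn s o) * (prodBernoulli w).real ((openConn s x)ᶜ ∩ (openConn s y)ᶜ ∩ openConn s b) ≤ (prodBernoulli w).real ((openConn s x)ᶜ ∩ (openConn s y)ᶜ) * (prodBernoulli w).real ((openConn s x)ᶜ ∩ (openConn s y)ᶜ ∩ (openConn s o ∩ openConn s b)) := by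
  intro n w s x y o b hsx hsy
  -- adapted from `stub_crossAnyOneTwo_c7` (…CrossAnyOneTwo) and `stub_diagPtTwo_c7` (…DiagPtTwo)
  have hSX : ∀ s' ∈ ({s} : Finset (Fin n)), s' ∉ ({x, y} : Set (Fin n)) := by
    intro s' hs'
    rw [Finset.mem_singleton] at hs'
    subst hs'
    simp only [Set.mem_insert_iff, Set.mem_singleton_iff, not_or]
    exact ⟨hsx, hsy⟩
  have key := stub_bhkOneAny_c7 n w {s} ({x, y} : Set (Fin n)) o b hSX
  have hD : {ω : BondConfig (Fin n) | ∀ s' ∈ ({s} : Finset (Fin n)), ∀ x' ∈ ({x, y} : Set (Fin n)),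
      ¬ (openGraph ω).Reachable s' x'} = (openConn s x)ᶜ ∩ (openConn s y)ᶜ := by
    ext ω
    simp only [Finset.mem_singleton, Set.mem_insert_iff, Set.mem_singleton_iff, forall_eq_or_imp,
      forall_eq, Set.mem_setOf_eq, Set.mem_inter_iff, Set.mem_compl_iff, openConn]
  have hO : (⋃ s' ∈ ({s} : Finset (Fin n)), openConn s' o : Set (BondConfig (Fin n))) =
      openConn s o :=
    Finset.set_biUnion_singleton s _
  have hB : (⋃ s' ∈ ({s} : Finset (Fin n)), openConn s' b : Set (BondConfig (Fin n))) =
      openConn s b :=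
    Finset.set_biUnion_singleton s _
  rw [hD, hO, hB] at key
  exact key

end

end Summit.CriticalPhenomena.PercolationContinuityZ3.Theorems
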